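import Literature.NumberTheory.LFunctions.AlternativeHypothesisLemma6PrintedRateProofs
import Literature.NumberTheory.LFunctions.AlternativeHypothesisCorollary4Proofs
import HarnessLib

/-!
# BGSTB 2025, Lemma 6 (v) WITH THE PRINTED ERROR TERMS — proved honestly (layer cake for the tent +
# Corollary 5 on unequal windows); the E-ah-5 scope completed: every printed statement of Lemma 6 is
# a tree theorem

Topic `Literature/NumberTheory/LFunctions` (namespace `Literature.NumberTheory.LFunctions`; helpers and
the core in the sub-namespace `AH`). PROOF LAYER, theorems only (no definitions, no named facts), cell
`rh-crit/ah` (C5, seat t5 g6, row «Lem6(v)-PRINTED», ruling R-g7-10). LABEL: **NOT RH-BEARING** —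
every statement with zeta content is a CONDITIONAL with `RiemannHypothesis` as antecedent and the
AH-Pairs data `(M, R)` (`AH.IsPairsRate M R`) or `AHPairsAt M` / `AHPairs` as hypothesis; §1 is pure
real analysis. Nothing here bears on the truth of RH or of AH.

S. A. C. Baluyot, D. A. Goldston, A. I. Suriajaya, C. L. Turnage-Butterbaugh, *The Alternative
Hypothesis for zeros of the Riemann zeta-function*, arXiv:2508.10857 (2025), UNREFEREED (D-0012);
TeX of record `rh-crit/ah/src/BGSTB2025_arXiv2508.10857.tex` (held text `paper:arxiv-2508.10857`):
§5 display (G_λ) (TeX l. 806): "`G_λ(α) := (1/λ²) ∫_{−λ}^{λ} (λ − |β|) F(α + β) dβ`"; display (E_G)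
(l. 819–820): "`E_G(λ, α) := 1/(λ²M) + (|α|+1)M²R(T) + 1/log T`, where `M`, `T`, and `R(T)` are from
AH-Pairs"; **Corollary 5** (l. 839–841); §6 **Lemma 6** (l. 928–954), item (v) (l. 949–953, VERBATIM):
"For `K` an odd integer, (v) `G_λ(K) = 2(P_0−1)/λ + O(1) + O(E_G(λ²,K)/λ) + O(1/(λ⁵√log T))`."
(standing hypotheses of the lemma, l. 928: "Assume the Riemann Hypothesis and AH-Pairs. Then for
`L ∈ ℤ` and `0 < λ ≤ 1/4` …"); the printed proof of (v) (l. 1026–1043) rests on (K=1iii) (l. 1023),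
obtained from the display l. 1012–1017.

## STATUS OF RECORD (cell `rh-crit/ah`, ref ruling #121 wording)

E-ah-5 = PROOF-DISPLAY ERRATUM of the source (stands in the kernel: the §6 display, third equality,
TeX l. 1012–1017, is false as printed — `AH.bgstb2025_lemma6_printed_display_fails`,
`AlternativeHypothesisLemma6Proofs` §4); printed STATEMENT (iii) PROVED M-uniformly by our route
(`bgstb2025_lemma6_iii_printed_usplit`, `AlternativeHypothesisLemma6PrintedRateProofs`, module 75);
printed STATEMENT (v): was OPEN — THIS file proves it, with the printed error terms and M-uniformly
(`bgstb2025_lemma6_v_printed_usplit`). With (i), (ii), (iv) (`bgstb2025_lemma6_i`, `bgstb2025_lemma6_ii`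
/ `_ii_uniform`, `bgstb2025_lemma6_iv`, `AlternativeHypothesisLemma6Proofs`) EVERY printed statement of
Lemma 6 is a tree theorem, none of them by the weak-as-typed `E_G`-absorption. This SUPERSEDES the
sentence of the module docstring of `AlternativeHypothesisLemma6PrintedRateProofs` (its l. 40–42:
"The printed (v) … is NOT proved honestly here (its upper half follows from (iii) …; its lower half
does not follow by averaging (iii))") — true of (iii), but (v) does not need (iii): it follows from
Corollary 5 on unequal windows directly, through the layer-cake identity below (finding F-t5g6-1).
The typed claim `bgstb2025_lemma6_v` is discharged AS TYPED elsewhere by the weakness of the typing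
(`bgstb2025_lemma6_v_holds`, `AlternativeHypothesisLemma6AsTyped`, module 72, finding F-t2g4-1); that
discharge lends no support to the printed rate and this file does not use it. LABEL: NOT RH-BEARING.

## What is proved here (OURS: a sound route to the PRINTED statement (v))

* §1 (ζ-free) **the layer cake for the tent** (`AH.integral_tent_mul_eq_integral_window`, any
  continuous `F`, by parts on each half-tent against the primitive `Φ(β) = ∫_0^β F(c + t) dt`):
  `∫_{−λ}^{λ} (λ − |β|) F(c + β) dβ = ∫_0^λ W(ν) dν`, `W(ν) := ∫_{c−ν}^{c+ν} F` — the tent is the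
  superposition of the flat windows; hence `λ² G_λ(c) = ∫_0^λ W(ν) dν`
  (`AH.sq_mul_heathBrownG_eq_integral_window`), and, with `V(ν) := ∫_{c−ν}^{c+ν} G_μ` and the smoothing
  sandwich of module 75 §1 (`W(ν − μ) ≤ V(ν) ≤ W(ν + μ)`, `W ≥ 0`), the **`ν`-sandwiches**
  `∫_μ^{λ−μ} V(ν) dν ≤ λ² G_λ(c) ≤ ∫_μ^{λ+μ} V(ν) dν` (`2μ ≤ λ`)
  (`AH.integral_window_heathBrownG_le_sq_mul_heathBrownG`,
  `AH.sq_mul_heathBrownG_le_integral_window_heathBrownG`).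
* §2 **Lemma 6 (v) with the printed error terms, CORE form** (`AH.lemma6_v_printed_core`, inputs
  abstracted as in `AlternativeHypothesisLemma6UniformProofs` §C and module 75: the conclusions of
  `AH.corollary5_window_core` (constant `C_w`) and `AH.heathBrownG_window_transport_core` (constant
  `C_t`) at level `M'`, rate `R'`, bins `M_b`, and a unit-window bound `∫_{c−1/2}^{c+1/2} F ≤ C_F`):
  at `μ = λ²`, for all large `T`,
  all `0 < λ ≤ 1/4`, all odd `K`,
  `|G_λ(K) − 2(P₀ − 1)/λ| ≤ (3|C_w| + 2|C_t| + 2|C_F|)(1 + E_G(λ², K)/λ + 1/(λ⁵ √log T))` —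
  `V(ν) = 2(P₀ − 1) + O(|C_w|(ν + E_G(μ,1) + 1/(μ²√log T)) + |C_t| ν E_G(μ,K))` for `μ ≤ ν ≤ λ + μ`;
  the main term integrates to exactly `2λ(P₀ − 1)` on the upper side and to `(λ − 2μ)·2(P₀ − 1)` on
  the lower side, the deficit `2μ·2(P₀ − 1)` being `≤ 2μ(|C_F| + e(μ))` because
  `2(P₀ − 1) ≤ V(μ) + e(μ) ≤ ∫_{K−2μ}^{K+2μ} F + e(μ)`; the printed `E_G(λ², ·)/λ` and `λ⁻⁵` are the
  smoothing scale `μ = λ²` integrated over `ν ∈ [μ, λ + μ]` and divided by `λ²`, the printed `O(1)` is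
  the window excess `λ²/λ²` and the deficit.
* §3 instantiations: `bgstb2025_lemma6_v_printed (hRH)` — the body of the typed claim
  `bgstb2025_lemma6_v` VERBATIM after its RH binder (honest constants; as a kernel statement implied by
  `bgstb2025_lemma6_v_holds` (M72, weak-as-typed); recorded because this proof has no
  `E_G`-absorption; not a discharge row, not named `_holds`); PRIMARY
  `bgstb2025_lemma6_v_printed_usplit (hRH)` — SPLIT constants over the row-U uniform input
  `AH.exists_uniform_input`: ABSOLUTE `K₀, A` (quantified BEFORE the level `M`) in front of
  `1 + A/(λ⁵M) + 1/(λ⁵√log T)`, the level-dependent data entering only the `T`-vanishing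
  `((|K|+1)(M/A)² R'(T) + 1/log T)/λ` with a positive rate `R'(T) → 0`; and the M-free form
  `AH.heathBrownG_odd_printedRate`: under RH and AH-Pairs, `|λ G_λ(K) − 2(P₀ − 1)| ≤ K₀ λ + ε` for all
  large `T`, every odd `K`, `0 < λ ≤ 1/4`, `ε > 0`, ONE absolute `K₀`.

## References

* [BaluyotGoldstonSuriajayaTurnageButterbaugh2025] arXiv:2508.10857, §5 (G_λ) (TeX l. 806), (E_G)
  (l. 819–820), Lemma 5 (l. 821–836), Corollary 5 (l. 839–841); §6 Lemma 6 (l. 928–954), (v)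
  (l. 949–953), (Hthm4) (l. 960), the printed proof of (iii)–(v) (l. 1007–1043; the display
  l. 1012–1017; the proof of (v), l. 1026–1043).
* D. A. Goldston, *On the function S(T) in the theory of the Riemann zeta-function*, J. Number Theory
  27 (1987) — the "[Goldston87]" of the source (§7: "uniformly for all `a = a(T)`,
  `∫_a^{a+1} F(α) dα ≪ 1`"); cited through BGSTB, not read here; in the tree as
  `exists_integral_formFactor_window_le` (`AlternativeHypothesisCorollary4Proofs`).
* Cell records: rh-crit/ah E-ah-5 (`AlternativeHypothesisLemma6Proofs` §4; ref ruling #121), row «U»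
  (`AlternativeHypothesisFormFactorUniformProofs`, `AlternativeHypothesisLemma6UniformProofs`),
  row «Lem6(iii)-PRINTED» (`AlternativeHypothesisLemma6PrintedRateProofs`), F-t2g4-1
  (`AlternativeHypothesisLemma6AsTyped`); ah/STATUS.md 2026-08-27T00:15:52Z (this row, F-t5g6-1),
  00:19:18Z (R-g7-10).
-/

noncomputable section

open scoped Real Topology
open Filter Set MeasureTheory

namespace Literature.NumberTheory.LFunctions

namespace AH

/-! ## §1. The layer cake for the tent and the `ν`-sandwiches (ζ-free: continuity and
non-negativity of `F` only) -/

/-- The symmetric window integral `ν ↦ ∫_{c−ν}^{c+ν} f` of a continuous `f` is continuous in the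
half-width `ν` (plumbing). [folklore] -/
private theorem continuous_integral_window {f : ℝ → ℝ} (hf : Continuous f) (c : ℝ) :
    Continuous fun ν : ℝ ↦ ∫ w in (c - ν)..(c + ν), f w := by
  have hfi : ∀ a b : ℝ, IntervalIntegrable f volume a b := fun a b ↦ hf.intervalIntegrable a b
  have hprim : Continuous fun x : ℝ ↦ ∫ w in (0 : ℝ)..x, f w :=
    intervalIntegral.continuous_primitive hfi 0
  have e : (fun ν : ℝ ↦ ∫ w in (c - ν)..(c + ν), f w) =
      fun ν ↦ (∫ w in (0 : ℝ)..(c + ν), f w) - ∫ w in (0 : ℝ)..(c - ν), f w := by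
    funext ν
    exact (intervalIntegral.integral_interval_sub_left (hfi _ _) (hfi _ _)).symm
  rw [e]
  exact (hprim.comp (continuous_const.add continuous_id)).sub
    (hprim.comp (continuous_const.sub continuous_id))

/-- **Layer cake for the tent.** For a continuous `F`, `λ ≥ 0` and any centre `c`,
`∫_{−λ}^{λ} (λ − |β|) F(c + β) dβ = ∫_0^λ (∫_{c−ν}^{c+ν} F(w) dw) dν` — the tent `(λ − |β|)₊` is the
superposition `∫_0^λ 𝟙_{|β| < ν} dν` of flat windows (proof: integration by parts on each half-tent
against the primitive `Φ(β) = ∫_0^β F(c + t) dt`) — the structure of the triangle weight `k_λ`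
of display (G_λ) and of `H_λ = λ² G_λ` in (Hthm4). OURS (elementary; not in the source, whose §6
handles `H_λ` by differencing in `λ` and by the interchange of E-ah-5 instead).
[cite: BaluyotGoldstonSuriajayaTurnageButterbaugh2025, §5 (G_λ), (k_λ); §6 (Hthm4)] -/
theorem integral_tent_mul_eq_integral_window {F : ℝ → ℝ} (hF : Continuous F) {lam : ℝ}
    (hlam : 0 ≤ lam) (c : ℝ) :
    ∫ β in (-lam)..lam, (lam - |β|) * F (c + β) =
      ∫ ν in (0 : ℝ)..lam, ∫ w in (c - ν)..(c + ν), F w := by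
  have hFc : Continuous fun t : ℝ ↦ F (c + t) := hF.comp (continuous_const.add continuous_id)
  have hFi : ∀ a b : ℝ, IntervalIntegrable (fun t : ℝ ↦ F (c + t)) volume a b :=
    fun a b ↦ hFc.intervalIntegrable a b
  -- the primitive `Φ(β) = ∫_0^β F(c + t) dt`
  set Φ : ℝ → ℝ := fun β ↦ ∫ t in (0 : ℝ)..β, F (c + t) with hΦ
  have hΦd : ∀ β, HasDerivAt Φ (F (c + β)) β := fun β ↦
    (hFc.integral_hasStrictDerivAt 0 β).hasDerivAt
  have hΦc : Continuous Φ := intervalIntegral.continuous_primitive hFi 0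
  have hΦ0 : Φ 0 = 0 := by simp [hΦ]
  -- the window as a difference of values of the primitive
  have hW : ∀ ν : ℝ, ∫ w in (c - ν)..(c + ν), F w = Φ ν - Φ (-ν) := by
    intro ν
    have h1 : ∫ t in (-ν)..ν, F (c + t) = ∫ w in (c - ν)..(c + ν), F w := by
      rw [intervalIntegral.integral_comp_add_left F c, ← sub_eq_add_neg]
    rw [← h1]
    exact (intervalIntegral.integral_interval_sub_left (hFi 0 ν) (hFi 0 (-ν))).symm
  -- split the tent integral at `0` and linearise `|β|` on each half
  have hti : ∀ a b : ℝ, IntervalIntegrable (fun β : ℝ ↦ (lam - |β|) * F (c + β)) volume a b :=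
    fun a b ↦ ((continuous_const.sub continuous_abs).mul hFc).intervalIntegrable a b
  have hsplit : ∫ β in (-lam)..lam, (lam - |β|) * F (c + β) =
      (∫ β in (-lam)..0, (lam + β) * F (c + β)) + ∫ β in (0 : ℝ)..lam, (lam - β) * F (c + β) := by
    rw [← intervalIntegral.integral_add_adjacent_intervals (hti (-lam) 0) (hti 0 lam)]
    congr 1
    · refine intervalIntegral.integral_congr fun β hβ ↦ ?_
      rw [Set.uIcc_of_le (by linarith)] at hβ
      show (lam - |β|) * F (c + β) = (lam + β) * F (c + β)
      rw [abs_of_nonpos hβ.2]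
      ring
    · refine intervalIntegral.integral_congr fun β hβ ↦ ?_
      rw [Set.uIcc_of_le hlam] at hβ
      show (lam - |β|) * F (c + β) = (lam - β) * F (c + β)
      rw [abs_of_nonneg hβ.1]
  -- by parts on `[0, λ]`: `u = λ − β`, `v = Φ`
  have hright : ∫ β in (0 : ℝ)..lam, (lam - β) * F (c + β) = ∫ β in (0 : ℝ)..lam, Φ β := by
    have hu : ∀ x ∈ Set.uIcc (0 : ℝ) lam, HasDerivAt (fun β : ℝ ↦ lam - β) (-1) x :=
      fun x _ ↦ by simpa using (hasDerivAt_id x).const_sub lam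
    have hv : ∀ x ∈ Set.uIcc (0 : ℝ) lam, HasDerivAt Φ (F (c + x)) x := fun x _ ↦ hΦd x
    have h := intervalIntegral.integral_mul_deriv_eq_deriv_mul hu hv
      ((continuous_const : Continuous fun _ : ℝ ↦ (-1 : ℝ)).intervalIntegrable _ _) (hFi 0 lam)
    rw [h, hΦ0]
    simp
  -- by parts on `[−λ, 0]`: `u = λ + β`, `v = Φ`
  have hleft : ∫ β in (-lam)..0, (lam + β) * F (c + β) = -∫ β in (-lam)..0, Φ β := by
    have hu : ∀ x ∈ Set.uIcc (-lam) (0 : ℝ), HasDerivAt (fun β : ℝ ↦ lam + β) 1 x :=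
      fun x _ ↦ by simpa using (hasDerivAt_id x).const_add lam
    have hv : ∀ x ∈ Set.uIcc (-lam) (0 : ℝ), HasDerivAt Φ (F (c + x)) x := fun x _ ↦ hΦd x
    have h := intervalIntegral.integral_mul_deriv_eq_deriv_mul hu hv
      ((continuous_const : Continuous fun _ : ℝ ↦ (1 : ℝ)).intervalIntegrable _ _) (hFi (-lam) 0)
    rw [h, hΦ0]
    simp
  -- reflect the left half onto `[0, λ]`
  have hrefl : ∫ β in (-lam)..0, Φ β = ∫ ν in (0 : ℝ)..lam, Φ (-ν) := by
    have h := intervalIntegral.integral_comp_neg (a := 0) (b := lam) Φ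
    rw [neg_zero] at h
    exact h.symm
  -- assemble
  calc ∫ β in (-lam)..lam, (lam - |β|) * F (c + β)
      = (∫ ν in (0 : ℝ)..lam, Φ ν) - ∫ ν in (0 : ℝ)..lam, Φ (-ν) := by
        rw [hsplit, hleft, hright, hrefl]; ring
    _ = ∫ ν in (0 : ℝ)..lam, (Φ ν - Φ (-ν)) :=
        (intervalIntegral.integral_sub (hΦc.intervalIntegrable _ _)
          ((hΦc.comp continuous_neg).intervalIntegrable _ _)).symm
    _ = ∫ ν in (0 : ℝ)..lam, ∫ w in (c - ν)..(c + ν), F w :=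
        intervalIntegral.integral_congr fun ν _ ↦ (hW ν).symm

/-- **Layer cake for `G_λ`**: `λ² G_λ(c, T) = ∫_0^λ (∫_{c−ν}^{c+ν} F(w, T) dw) dν` for `λ > 0`
(`G_λ = AH.heathBrownG`, `F = montgomeryFormFactor`). OURS.
[cite: BaluyotGoldstonSuriajayaTurnageButterbaugh2025, §5 (G_λ)] -/
theorem sq_mul_heathBrownG_eq_integral_window {lam : ℝ} (hlam : 0 < lam) (c T : ℝ) :
    lam ^ 2 * heathBrownG lam c T =
      ∫ ν in (0 : ℝ)..lam, ∫ w in (c - ν)..(c + ν), montgomeryFormFactor w T := by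
  unfold heathBrownG
  rw [← mul_assoc, show lam ^ 2 * (1 / lam ^ 2) = 1 by field_simp, one_mul]
  exact integral_tent_mul_eq_integral_window (RudnickSarnak.continuous_montgomeryFormFactor T)
    hlam.le c

/-- **Upper `ν`-sandwich**: for `μ > 0`, `λ > 0`, `T > 1` and any centre `c`,
`λ² G_λ(c) ≤ ∫_μ^{λ+μ} (∫_{c−ν}^{c+ν} G_μ(α) dα) dν` — by the layer cake,
`λ² G_λ(c) = ∫_μ^{λ+μ} W(ν − μ) dν` with `W(ν) = ∫_{c−ν}^{c+ν} F`, and `W(ν − μ) ≤ ∫_{c−ν}^{c+ν} G_μ`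
(`AH.integral_formFactor_le_integral_heathBrownG`). OURS.
[cite: BaluyotGoldstonSuriajayaTurnageButterbaugh2025, §6 (proof of Lemma 6 (iii)–(v))] -/
theorem sq_mul_heathBrownG_le_integral_window_heathBrownG {mu lam : ℝ} (hmu : 0 < mu)
    (hlam : 0 < lam) {T : ℝ} (hT : 1 < T) (c : ℝ) :
    lam ^ 2 * heathBrownG lam c T ≤
      ∫ ν in mu..(lam + mu), ∫ α in (c - ν)..(c + ν), heathBrownG mu α T := by
  have hF := RudnickSarnak.continuous_montgomeryFormFactor T
  have hWc : Continuous fun ν : ℝ ↦ ∫ w in (c - ν)..(c + ν), montgomeryFormFactor w T :=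
    continuous_integral_window hF c
  have hVc : Continuous fun ν : ℝ ↦ ∫ α in (c - ν)..(c + ν), heathBrownG mu α T :=
    continuous_integral_window (continuous_heathBrownG mu T) c
  rw [sq_mul_heathBrownG_eq_integral_window hlam c T]
  have hshift : ∫ ν in (0 : ℝ)..lam, (∫ w in (c - ν)..(c + ν), montgomeryFormFactor w T) =
      ∫ ν in mu..(lam + mu), ∫ w in (c - (ν - mu))..(c + (ν - mu)), montgomeryFormFactor w T := by
    have h := intervalIntegral.integral_comp_sub_right (a := mu) (b := lam + mu)
      (fun ν ↦ ∫ w in (c - ν)..(c + ν), montgomeryFormFactor w T) mu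
    simp only [sub_self, add_sub_cancel_right] at h
    rw [← h]
  rw [hshift]
  refine intervalIntegral.integral_mono_on (by linarith) ?_ (hVc.intervalIntegrable _ _)
    fun ν hν ↦ ?_
  · exact (hWc.comp (continuous_id.sub continuous_const)).intervalIntegrable _ _
  · exact integral_formFactor_le_integral_heathBrownG hmu hν.1 hT c

/-- **Lower `ν`-sandwich**: for `μ > 0`, `2μ ≤ λ`, `T > 1` and any centre `c`,
`∫_μ^{λ−μ} (∫_{c−ν}^{c+ν} G_μ(α) dα) dν ≤ λ² G_λ(c)` — since `∫_{c−ν}^{c+ν} G_μ ≤ W(ν + μ)`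
(`AH.integral_heathBrownG_le_integral_formFactor`), `∫_μ^{λ−μ} W(ν + μ) dν = ∫_{2μ}^{λ} W ≤ ∫_0^λ W`
(`W ≥ 0`) and the layer cake. OURS.
[cite: BaluyotGoldstonSuriajayaTurnageButterbaugh2025, §6 (proof of Lemma 6 (iii)–(v))] -/
theorem integral_window_heathBrownG_le_sq_mul_heathBrownG {mu lam : ℝ} (hmu : 0 < mu)
    (h2 : 2 * mu ≤ lam) {T : ℝ} (hT : 1 < T) (c : ℝ) :
    ∫ ν in mu..(lam - mu), ∫ α in (c - ν)..(c + ν), heathBrownG mu α T ≤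
      lam ^ 2 * heathBrownG lam c T := by
  have hlam : 0 < lam := by linarith
  have hF := RudnickSarnak.continuous_montgomeryFormFactor T
  have hWc : Continuous fun ν : ℝ ↦ ∫ w in (c - ν)..(c + ν), montgomeryFormFactor w T :=
    continuous_integral_window hF c
  have hVc : Continuous fun ν : ℝ ↦ ∫ α in (c - ν)..(c + ν), heathBrownG mu α T :=
    continuous_integral_window (continuous_heathBrownG mu T) c
  rw [sq_mul_heathBrownG_eq_integral_window hlam c T]
  have h1 : ∫ ν in mu..(lam - mu), (∫ α in (c - ν)..(c + ν), heathBrownG mu α T) ≤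
      ∫ ν in mu..(lam - mu), ∫ w in (c - (ν + mu))..(c + (ν + mu)), montgomeryFormFactor w T := by
    refine intervalIntegral.integral_mono_on (by linarith) (hVc.intervalIntegrable _ _) ?_
      fun ν hν ↦ ?_
    · exact (hWc.comp (continuous_id.add continuous_const)).intervalIntegrable _ _
    · exact integral_heathBrownG_le_integral_formFactor hmu (by linarith [hν.1]) hT c
  have h2' : ∫ ν in mu..(lam - mu),
        (∫ w in (c - (ν + mu))..(c + (ν + mu)), montgomeryFormFactor w T) =
      ∫ ν in (2 * mu)..lam, ∫ w in (c - ν)..(c + ν), montgomeryFormFactor w T := by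
    have h := intervalIntegral.integral_comp_add_right (a := mu) (b := lam - mu)
      (fun ν ↦ ∫ w in (c - ν)..(c + ν), montgomeryFormFactor w T) mu
    simp only [sub_add_cancel] at h
    rw [h, two_mul]
  have h3 : ∫ ν in (2 * mu)..lam, (∫ w in (c - ν)..(c + ν), montgomeryFormFactor w T) ≤
      ∫ ν in (0 : ℝ)..lam, ∫ w in (c - ν)..(c + ν), montgomeryFormFactor w T := by
    refine intervalIntegral.integral_mono_interval (by linarith) h2 le_rfl ?_
      (hWc.intervalIntegrable _ _)
    refine MeasureTheory.ae_restrict_of_forall_mem measurableSet_Ioc fun ν hν ↦ ?_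
    exact intervalIntegral.integral_nonneg (by linarith [hν.1.le])
      fun w _ ↦ Montgomery.montgomeryFormFactor_nonneg w hT
  exact h1.trans (h2'.le.trans h3)


/-! ## §2. Lemma 6 (v) with the printed error terms (CORE form) -/

set_option maxHeartbeats 400000 in
/-- **BGSTB 2025, Lemma 6 (v) WITH THE PRINTED ERROR TERMS, CORE form.** From Corollary 5 on
unequal windows (constant `C_w`: the conclusion of `AH.corollary5_window_core`), the transport
`1 ↦ K = 2L + 1` (constant `C_t`: the conclusion of `AH.heathBrownG_window_transport_core`) at
level `M'`, rate `R'`, bins at `Mb`, and a bound `C_F` for the unit windows of `F` (the conclusion of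
`exists_integral_formFactor_window_le`): for all large `T`, all `0 < λ ≤ 1/4` and all odd `K`,
`|G_λ(K) − 2(P₀ − 1)/λ| ≤ (3|C_w| + 2|C_t| + 2|C_F|)(1 + E_G(λ², K)/λ + 1/(λ⁵ √log T))`.
Route (OURS): smoothing radius `μ = λ²`; by the `ν`-sandwiches of §1,
`∫_μ^{λ−μ} V ≤ λ² G_λ(K) ≤ ∫_μ^{λ+μ} V` with `V(ν) = ∫_{K−ν}^{K+ν} G_μ = 2(P₀ − 1) + O(e(ν))`,
`e(ν) = |C_w|(ν + E_G(μ,1) + 1/(μ²√log T)) + |C_t| ν E_G(μ,K)` for `μ ≤ ν ≤ λ + μ`; the main term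
integrates to `2λ(P₀ − 1)` above and to `(λ − 2μ) 2(P₀ − 1)` below, the deficit being
`≤ 2μ(|C_F| + e(μ))` because `2(P₀ − 1) ≤ V(μ) + e(μ) ≤ ∫_{K−2μ}^{K+2μ} F + e(μ) ≤ C_F + e(μ)`. Printed:
"For `K` an odd integer, (v) `G_λ(K) = 2(P_0−1)/λ + O(1) + O(E_G(λ²,K)/λ) + O(1/(λ⁵√log T))`"
(Lemma 6, TeX l. 949–953) — the statement, by a route different from the printed proof
(l. 1026–1043, which rests on the display l. 1012–1017, E-ah-5).
[cite: BaluyotGoldstonSuriajayaTurnageButterbaugh2025, Lemma 6 (v)] -/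
theorem lemma6_v_printed_core {Cw Ct CF Mb M' δ : ℝ} {R' : ℝ → ℝ} (hM' : 0 < M')
    (hR0 : ∀ T, 0 < R' T)
    (hW : ∀ᶠ T : ℝ in atTop, ∀ mu nu : ℝ, 0 < mu → mu ≤ nu → mu ≤ 1 / 4 → nu ≤ 1 / 2 →
      |(∫ α in (1 - nu)..(1 + nu), heathBrownG mu α T) - 2 * (binDensity 0 T Mb δ - 1)| ≤
        Cw * (nu + errG M' (R' T) T mu 1 + 1 / (mu ^ 2 * Real.sqrt (Real.log T))))
    (hTr : ∀ᶠ T : ℝ in atTop, ∀ mu nu : ℝ, 0 < mu → mu ≤ 1 / 2 → 0 ≤ nu → nu ≤ 1 → ∀ L : ℤ,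
      |(∫ α in ((2 * L + 1 : ℝ) - nu)..((2 * L + 1 : ℝ) + nu), heathBrownG mu α T) -
          ∫ α in (1 - nu)..(1 + nu), heathBrownG mu α T| ≤
        Ct * nu * errG M' (R' T) T mu (2 * L + 1))
    (hF : ∀ᶠ T : ℝ in atTop, ∀ c : ℝ,
      ∫ a in (c - 1 / 2)..(c + 1 / 2), montgomeryFormFactor a T ≤ CF) :
    ∀ᶠ T : ℝ in atTop, ∀ lam : ℝ, 0 < lam → lam ≤ 1 / 4 → ∀ K : ℤ, Odd K →
      |heathBrownG lam K T - 2 * (binDensity 0 T Mb δ - 1) / lam| ≤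
        (3 * |Cw| + 2 * |Ct| + 2 * |CF|) *
          (1 + errG M' (R' T) T (lam ^ 2) K / lam + 1 / (lam ^ 5 * Real.sqrt (Real.log T))) := by
  filter_upwards [hW, hTr, hF, eventually_gt_atTop (1 : ℝ)] with T hTW hTT hTF hT1 lam hlam hlam4 K hK
  obtain ⟨L, rfl⟩ := hK
  push_cast
  have hlog : 0 < Real.log T := Real.log_pos hT1
  have hsq : 0 < Real.sqrt (Real.log T) := Real.sqrt_pos.mpr hlog
  have hRT : 0 < R' T := hR0 T
  have hFc := RudnickSarnak.continuous_montgomeryFormFactor T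
  -- the smoothing scale `μ = λ²`
  have hmu : 0 < lam ^ 2 := by positivity
  have hmul : lam ^ 2 ≤ lam / 4 := by nlinarith only [hlam, hlam4]
  have h2mu : 2 * lam ^ 2 ≤ lam := by linarith
  have hmu4 : lam ^ 2 ≤ 1 / 4 := by linarith
  have hmu2 : lam ^ 2 ≤ 1 / 2 := by linarith
  have hlam1 : lam ≤ 1 := by linarith
  -- notation
  set E : ℝ := errG M' (R' T) T (lam ^ 2) (2 * L + 1) with hE
  set E1 : ℝ := errG M' (R' T) T (lam ^ 2) 1 with hE1
  set Q : ℝ := 1 / ((lam ^ 2) ^ 2 * Real.sqrt (Real.log T)) with hQ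
  set X : ℝ := 2 * (binDensity 0 T Mb δ - 1) with hX
  have hE0 : 0 ≤ E := by rw [hE]; unfold errG; positivity
  have hE10 : 0 ≤ E1 := by rw [hE1]; unfold errG; positivity
  have hQ0 : 0 ≤ Q := by positivity
  have hE1E : E1 ≤ E := by
    rw [hE1, hE]
    refine errG_mono_abs hRT.le ?_
    rw [abs_one]
    have h : (2 * (L : ℝ) + 1) = ((2 * L + 1 : ℤ) : ℝ) := by push_cast; ring
    rw [h, ← Int.cast_abs]
    exact_mod_cast Int.one_le_abs (by omega : (2 * L + 1 : ℤ) ≠ 0)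
  have hCw0 : 0 ≤ |Cw| := abs_nonneg _
  have hCt0 : 0 ≤ |Ct| := abs_nonneg _
  have hCF0 : 0 ≤ |CF| := abs_nonneg _
  -- continuity of the window integral of `G_μ` in the half-width
  have hVc : Continuous fun ν : ℝ ↦
      ∫ α in ((2 * (L : ℝ) + 1) - ν)..((2 * (L : ℝ) + 1) + ν), heathBrownG (lam ^ 2) α T :=
    continuous_integral_window (continuous_heathBrownG (lam ^ 2) T) _
  -- the pointwise window estimate for `μ ≤ ν ≤ λ + μ`
  have hpt : ∀ ν : ℝ, lam ^ 2 ≤ ν → ν ≤ lam + lam ^ 2 →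
      |(∫ α in ((2 * (L : ℝ) + 1) - ν)..((2 * (L : ℝ) + 1) + ν), heathBrownG (lam ^ 2) α T) - X| ≤
        |Cw| * (ν + E1 + Q) + |Ct| * ν * E := by
    intro ν h1 h2
    have hν2 : ν ≤ 1 / 2 := by linarith
    have hν0 : 0 ≤ ν := by linarith
    have hν1 : ν ≤ 1 := by linarith
    have hw := hTW (lam ^ 2) ν hmu h1 hmu4 hν2
    have ht := hTT (lam ^ 2) ν hmu hmu2 hν0 hν1 L
    have hw' : |(∫ α in (1 - ν)..(1 + ν), heathBrownG (lam ^ 2) α T) - X| ≤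
        |Cw| * (ν + E1 + Q) :=
      hw.trans (mul_le_mul_of_nonneg_right (le_abs_self _) (by positivity))
    have ht' : |(∫ α in ((2 * (L : ℝ) + 1) - ν)..((2 * (L : ℝ) + 1) + ν), heathBrownG (lam ^ 2) α T) -
        ∫ α in (1 - ν)..(1 + ν), heathBrownG (lam ^ 2) α T| ≤ |Ct| * ν * E := by
      refine ht.trans ?_
      have : 0 ≤ ν * E := by positivity
      calc Ct * ν * E = Ct * (ν * E) := by ring
        _ ≤ |Ct| * (ν * E) := mul_le_mul_of_nonneg_right (le_abs_self _) this
        _ = |Ct| * ν * E := by ring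
    calc |(∫ α in ((2 * (L : ℝ) + 1) - ν)..((2 * (L : ℝ) + 1) + ν), heathBrownG (lam ^ 2) α T) - X|
        = |((∫ α in ((2 * (L : ℝ) + 1) - ν)..((2 * (L : ℝ) + 1) + ν), heathBrownG (lam ^ 2) α T) -
              ∫ α in (1 - ν)..(1 + ν), heathBrownG (lam ^ 2) α T) +
            ((∫ α in (1 - ν)..(1 + ν), heathBrownG (lam ^ 2) α T) - X)| := by ring_nf
      _ ≤ _ := abs_add_le _ _
      _ ≤ |Ct| * ν * E + |Cw| * (ν + E1 + Q) := add_le_add ht' hw'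
      _ = |Cw| * (ν + E1 + Q) + |Ct| * ν * E := by ring
  ---------------------------------------------------------------------------
  -- UPPER: `λ² G_λ(K) ≤ ∫_μ^{λ+μ} V ≤ λ · c₁`
  ---------------------------------------------------------------------------
  set c₁ : ℝ := X + |Cw| * ((lam + lam ^ 2) + E1 + Q) + |Ct| * (lam + lam ^ 2) * E with hc₁
  have hU1 := sq_mul_heathBrownG_le_integral_window_heathBrownG hmu hlam hT1 (2 * (L : ℝ) + 1)
  have hU2 : ∫ ν in (lam ^ 2)..(lam + lam ^ 2),
        (∫ α in ((2 * (L : ℝ) + 1) - ν)..((2 * (L : ℝ) + 1) + ν), heathBrownG (lam ^ 2) α T) ≤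
      ∫ _ν in (lam ^ 2)..(lam + lam ^ 2), c₁ := by
    refine intervalIntegral.integral_mono_on (by linarith) (hVc.intervalIntegrable _ _)
      (continuous_const.intervalIntegrable _ _) fun ν hν ↦ ?_
    have h := (abs_le.mp (hpt ν hν.1 hν.2)).2
    have hνE : |Ct| * ν * E ≤ |Ct| * (lam + lam ^ 2) * E := by
      have : ν * E ≤ (lam + lam ^ 2) * E := mul_le_mul_of_nonneg_right hν.2 hE0
      calc |Ct| * ν * E = |Ct| * (ν * E) := by ring
        _ ≤ |Ct| * ((lam + lam ^ 2) * E) := mul_le_mul_of_nonneg_left this hCt0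
        _ = |Ct| * (lam + lam ^ 2) * E := by ring
    have hνw : |Cw| * (ν + E1 + Q) ≤ |Cw| * ((lam + lam ^ 2) + E1 + Q) :=
      mul_le_mul_of_nonneg_left (by linarith [hν.2]) hCw0
    rw [hc₁]
    linarith
  have hU3 : ∫ _ν in (lam ^ 2)..(lam + lam ^ 2), c₁ = lam * c₁ := by
    rw [intervalIntegral.integral_const, smul_eq_mul]
    ring
  have hUP : lam ^ 2 * heathBrownG lam (2 * (L : ℝ) + 1) T ≤ lam * c₁ := by
    linarith [hU1, hU2, hU3.le, hU3.ge]
  ---------------------------------------------------------------------------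
  -- LOWER: `λ² G_λ(K) ≥ ∫_μ^{λ−μ} V ≥ (λ − 2μ) c₀ ≥ λ c₀ − 2μ B₀`
  ---------------------------------------------------------------------------
  set c₀ : ℝ := X - |Cw| * (lam + E1 + Q) - |Ct| * lam * E with hc₀
  set B₀ : ℝ := |CF| + |Cw| * (lam ^ 2 + E1 + Q) + |Ct| * lam ^ 2 * E with hB₀
  have hL1 := integral_window_heathBrownG_le_sq_mul_heathBrownG hmu h2mu hT1 (2 * (L : ℝ) + 1)
  have hL2 : ∫ _ν in (lam ^ 2)..(lam - lam ^ 2), c₀ ≤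
      ∫ ν in (lam ^ 2)..(lam - lam ^ 2),
        ∫ α in ((2 * (L : ℝ) + 1) - ν)..((2 * (L : ℝ) + 1) + ν), heathBrownG (lam ^ 2) α T := by
    refine intervalIntegral.integral_mono_on (by linarith) (continuous_const.intervalIntegrable _ _)
      (hVc.intervalIntegrable _ _) fun ν hν ↦ ?_
    have hν2 : ν ≤ lam + lam ^ 2 := by linarith [hν.2]
    have h := (abs_le.mp (hpt ν hν.1 hν2)).1
    have hνl : ν ≤ lam := by linarith [hν.2]
    have hνE : |Ct| * ν * E ≤ |Ct| * lam * E := by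
      have : ν * E ≤ lam * E := mul_le_mul_of_nonneg_right hνl hE0
      calc |Ct| * ν * E = |Ct| * (ν * E) := by ring
        _ ≤ |Ct| * (lam * E) := mul_le_mul_of_nonneg_left this hCt0
        _ = |Ct| * lam * E := by ring
    have hνw : |Cw| * (ν + E1 + Q) ≤ |Cw| * (lam + E1 + Q) :=
      mul_le_mul_of_nonneg_left (by linarith) hCw0
    rw [hc₀]
    linarith
  have hL3 : ∫ _ν in (lam ^ 2)..(lam - lam ^ 2), c₀ = (lam - 2 * lam ^ 2) * c₀ := by
    rw [intervalIntegral.integral_const, smul_eq_mul]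
    ring
  -- `X ≤ B₀`: Corollary 5 at `ν = μ`, the sandwich `V(μ) ≤ ∫_{K−2μ}^{K+2μ} F`, the window bound
  have hXB : X ≤ B₀ := by
    have h := (abs_le.mp (hpt (lam ^ 2) le_rfl (by linarith))).1
    have hVW : (∫ α in ((2 * (L : ℝ) + 1) - lam ^ 2)..((2 * (L : ℝ) + 1) + lam ^ 2),
          heathBrownG (lam ^ 2) α T) ≤
        ∫ w in ((2 * (L : ℝ) + 1) - (lam ^ 2 + lam ^ 2))..((2 * (L : ℝ) + 1) + (lam ^ 2 + lam ^ 2)),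
          montgomeryFormFactor w T :=
      integral_heathBrownG_le_integral_formFactor hmu hmu.le hT1 _
    have hWF : (∫ w in ((2 * (L : ℝ) + 1) - (lam ^ 2 + lam ^ 2))..((2 * (L : ℝ) + 1) + (lam ^ 2 + lam ^ 2)),
          montgomeryFormFactor w T) ≤ CF := by
      refine le_trans ?_ (hTF (2 * (L : ℝ) + 1))
      refine intervalIntegral.integral_mono_interval (by linarith) (by linarith) (by linarith)
        (Eventually.of_forall fun w ↦ Montgomery.montgomeryFormFactor_nonneg w hT1)
        (hFc.intervalIntegrable _ _)
    have hCF : CF ≤ |CF| := le_abs_self _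
    rw [hB₀]
    linarith
  have hLOW : lam * c₀ - 2 * lam ^ 2 * B₀ ≤ lam ^ 2 * heathBrownG lam (2 * (L : ℝ) + 1) T := by
    -- `(λ − 2μ) c₀ ≥ λ c₀ − 2μ B₀` since `c₀ ≤ X ≤ B₀`
    have hc₀X : c₀ ≤ B₀ := by
      rw [hc₀]
      have : 0 ≤ |Cw| * (lam + E1 + Q) := by positivity
      have : 0 ≤ |Ct| * lam * E := by positivity
      linarith
    have hdef : lam * c₀ - 2 * lam ^ 2 * B₀ ≤ (lam - 2 * lam ^ 2) * c₀ := by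
      have : 0 ≤ 2 * lam ^ 2 * (B₀ - c₀) := mul_nonneg (by positivity) (sub_nonneg.mpr hc₀X)
      linarith
    linarith [hL1, hL2, hL3.le, hL3.ge]
  ---------------------------------------------------------------------------
  -- bookkeeping: `|λ² G − λ X| ≤ C_v (λ² + λ E + λ Q)`
  ---------------------------------------------------------------------------
  have f1 : lam ^ 3 ≤ lam ^ 2 / 4 := by
    have h := mul_le_mul_of_nonneg_left hmul hlam.le
    calc lam ^ 3 = lam * lam ^ 2 := by ring
      _ ≤ lam * (lam / 4) := h
      _ = lam ^ 2 / 4 := by ring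
  have f2 : lam ^ 4 ≤ lam ^ 2 / 16 := by
    calc lam ^ 4 = (lam ^ 2) ^ 2 := by ring
      _ ≤ (lam / 4) ^ 2 := pow_le_pow_left₀ hmu.le hmul 2
      _ = lam ^ 2 / 16 := by ring
  have key : |lam ^ 2 * heathBrownG lam (2 * (L : ℝ) + 1) T - lam * X| ≤
      (3 * |Cw| + 2 * |Ct| + 2 * |CF|) * (lam ^ 2 + lam * E + lam * Q) := by
    -- the product inequalities `linarith` needs
    have u1 : |Cw| * lam ^ 3 ≤ |Cw| * (lam ^ 2 / 4) := mul_le_mul_of_nonneg_left f1 hCw0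
    have u2 : |Cw| * (lam * E1) ≤ |Cw| * (lam * E) :=
      mul_le_mul_of_nonneg_left (mul_le_mul_of_nonneg_left hE1E hlam.le) hCw0
    have u3 : |Ct| * ((lam ^ 2 + lam ^ 3) * E) ≤ |Ct| * (lam * E / 2) := by
      refine mul_le_mul_of_nonneg_left ?_ hCt0
      have h : lam ^ 2 + lam ^ 3 ≤ lam / 2 := by linarith
      calc (lam ^ 2 + lam ^ 3) * E ≤ (lam / 2) * E := mul_le_mul_of_nonneg_right h hE0
        _ = lam * E / 2 := by ring
    have l2 : |Ct| * (lam ^ 2 * E) ≤ |Ct| * (lam * E / 4) := by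
      refine mul_le_mul_of_nonneg_left ?_ hCt0
      calc lam ^ 2 * E ≤ (lam / 4) * E := mul_le_mul_of_nonneg_right hmul hE0
        _ = lam * E / 4 := by ring
    have l3 : |Cw| * lam ^ 4 ≤ |Cw| * (lam ^ 2 / 16) := mul_le_mul_of_nonneg_left f2 hCw0
    have l4 : |Cw| * (lam ^ 2 * E1) ≤ |Cw| * (lam * E / 4) := by
      refine mul_le_mul_of_nonneg_left ?_ hCw0
      calc lam ^ 2 * E1 ≤ lam ^ 2 * E := mul_le_mul_of_nonneg_left hE1E hmu.le
        _ ≤ (lam / 4) * E := mul_le_mul_of_nonneg_right hmul hE0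
        _ = lam * E / 4 := by ring
    have l5 : |Cw| * (lam ^ 2 * Q) ≤ |Cw| * (lam * Q / 4) := by
      refine mul_le_mul_of_nonneg_left ?_ hCw0
      calc lam ^ 2 * Q ≤ (lam / 4) * Q := mul_le_mul_of_nonneg_right hmul hQ0
        _ = lam * Q / 4 := by ring
    have l6 : |Ct| * (lam ^ 4 * E) ≤ |Ct| * (lam * E / 64) := by
      refine mul_le_mul_of_nonneg_left ?_ hCt0
      have h : lam ^ 4 ≤ lam / 64 := by linarith
      calc lam ^ 4 * E ≤ (lam / 64) * E := mul_le_mul_of_nonneg_right h hE0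
        _ = lam * E / 64 := by ring
    have p1 : 0 ≤ |CF| * lam ^ 2 := by positivity
    have p2 : 0 ≤ |Cw| * (lam * Q) := by positivity
    have p3 : 0 ≤ |Cw| * (lam * E) := by positivity
    have p4 : 0 ≤ |Ct| * (lam * E) := by positivity
    have p5 : 0 ≤ |Cw| * lam ^ 2 := by positivity
    have p6 : 0 ≤ |Ct| * lam ^ 2 := by positivity
    have p7 : 0 ≤ |Ct| * (lam * Q) := by positivity
    have p8 : 0 ≤ |CF| * (lam * E) := by positivity
    have p9 : 0 ≤ |CF| * (lam * Q) := by positivity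
    rw [abs_le]
    constructor
    · -- lower: `λ X − λ² G ≤ λ (X − c₀) + 2μ B₀`
      have e : lam * X - (lam * c₀ - 2 * lam ^ 2 * B₀) =
          |Cw| * lam ^ 2 + |Cw| * (lam * E1) + |Cw| * (lam * Q) + |Ct| * (lam ^ 2 * E) +
            2 * (|CF| * lam ^ 2) + 2 * (|Cw| * lam ^ 4) + 2 * (|Cw| * (lam ^ 2 * E1)) +
            2 * (|Cw| * (lam ^ 2 * Q)) + 2 * (|Ct| * (lam ^ 4 * E)) := by
        rw [hc₀, hB₀]; ring
      linarith [hLOW, e, u2, l2, l3, l4, l5, l6, p1, p2, p3, p4, p5, p6, p7, p8, p9]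
    · -- upper: `λ² G − λ X ≤ λ (c₁ − X)`
      have e : lam * c₁ - lam * X =
          |Cw| * lam ^ 2 + |Cw| * lam ^ 3 + |Cw| * (lam * E1) + |Cw| * (lam * Q) +
            |Ct| * ((lam ^ 2 + lam ^ 3) * E) := by
        rw [hc₁]; ring
      linarith [hUP, e, u1, u2, u3, p1, p2, p3, p4, p5, p6, p7, p8, p9]
  ---------------------------------------------------------------------------
  -- divide by `λ²`
  ---------------------------------------------------------------------------
  have hl0 : lam ≠ 0 := hlam.ne'
  have hs0 : Real.sqrt (Real.log T) ≠ 0 := hsq.ne'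
  have hgoal : heathBrownG lam (2 * (L : ℝ) + 1) T - X / lam =
      (lam ^ 2 * heathBrownG lam (2 * (L : ℝ) + 1) T - lam * X) / lam ^ 2 := by
    field_simp
  rw [hgoal, abs_div, abs_of_pos (by positivity : (0 : ℝ) < lam ^ 2),
    div_le_iff₀ (by positivity : (0 : ℝ) < lam ^ 2)]
  refine key.trans (le_of_eq ?_)
  rw [hQ]
  field_simp

end AH

/-! ## §3. Instantiations: the typed binders (honest constants), the M-uniform split form, and the
M-free `O(λ)`-rate form -/

open AH in
/-- **BGSTB 2025, Lemma 6 (v) with the printed error terms — the body of the typed claim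
`bgstb2025_lemma6_v` VERBATIM after its `RiemannHypothesis` binder, proved by the route of this file**
(layer cake + Corollary 5 on unequal windows at `μ = λ²`), from RH via the tree's Lemma 5 (i)–(ii)
(`bgstb2025_lemma5_rh_holds`), the AH half in the form §5 proves (`bgstb2025_lemma5_ah_of_RH`) and
the unit-window bound for `F` (`exists_integral_formFactor_window_le`): for AH-Pairs data `(M, R)`
and a bin half-width `0 < δ ≤ 1/2` there is `C` with, for all large `T`, all `0 < λ ≤ 1/4` and all
odd `K`, `|G_λ(K, T) − 2(P₀(T) − 1)/λ| ≤ C(1 + E_G(λ², K)/λ + 1/(λ⁵ √log T))`.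
As a kernel STATEMENT this is implied by `bgstb2025_lemma6_v_holds`
(`AlternativeHypothesisLemma6AsTyped`, module 72 of cell rh-crit/ah, weak-as-typed: `∃ C` after
`∀ M` absorbing the RH-bounded left side into `E_G ≥ 1/(μ²M)`); recorded because THIS proof has no
`E_G`-absorption — the constant is the core's `3|C_w| + 2|C_t| + 2|C_F|`, inheriting the level
dependence of the tree's `bgstb2025_lemma5_ah_of_RH` only; the M-uniform content is
`bgstb2025_lemma6_v_printed_usplit`. Not a discharge row (the typed claim is already discharged);
not named `_holds`. Printed: Lemma 6 (v), TeX l. 949–953 (quoted in the module docstring).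
[cite: BaluyotGoldstonSuriajayaTurnageButterbaugh2025, Lemma 6 (v)] -/
theorem bgstb2025_lemma6_v_printed (hRH : RiemannHypothesis) :
    ∀ M : ℝ, 0 < M → ∀ R : ℝ → ℝ, AH.IsPairsRate M R → ∀ δ : ℝ, 0 < δ → δ ≤ 1 / 2 →
      ∃ C : ℝ, ∀ᶠ T : ℝ in atTop, ∀ lam : ℝ, 0 < lam → lam ≤ 1 / 4 → ∀ K : ℤ, Odd K →
        |AH.heathBrownG lam K T - 2 * (AH.binDensity 0 T M δ - 1) / lam| ≤
          C * (1 + AH.errG M (R T) T (lam ^ 2) K / lam + 1 / (lam ^ 5 * Real.sqrt (Real.log T))) := by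
  intro M hM R hR δ hδ hδ2
  obtain ⟨C₁, h₁⟩ := (bgstb2025_lemma5_rh_holds hRH).2
  obtain ⟨C₂, h₂⟩ := bgstb2025_lemma5_ah_of_RH hRH M hM R hR δ hδ hδ2
  obtain ⟨CF, hF⟩ := exists_integral_formFactor_window_le hRH
  have hR0 : ∀ T, 0 < R T := hR.1
  have hW := corollary5_window_core (Mb := M) hM hR0 (by linarith) h₁ h₂
  have hTr := heathBrownG_window_transport_core hM hR0
    (h₂.mono fun T hT lam hlam hlam2 α L ↦ (hT lam hlam hlam2 α).2 L)
  exact ⟨_, lemma6_v_printed_core hM hR0 hW hTr hF⟩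

/-- `1/log T → 0`. [folklore] -/
private theorem tendsto_one_div_log'' : Tendsto (fun T : ℝ ↦ 1 / Real.log T) atTop (𝓝 0) := by
  have h : Tendsto (fun T : ℝ ↦ (Real.log T)⁻¹) atTop (𝓝 0) :=
    Real.tendsto_log_atTop.inv_tendsto_atTop
  simpa [one_div] using h

/-- `c/√(log T) → 0`. [folklore] -/
private theorem tendsto_const_div_sqrt_log'' (c : ℝ) :
    Tendsto (fun T : ℝ ↦ c / Real.sqrt (Real.log T)) atTop (𝓝 0) := by
  have h := ((Real.tendsto_sqrt_atTop.comp Real.tendsto_log_atTop).inv_tendsto_atTop).const_mul c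
  rw [mul_zero] at h
  refine h.congr' (Eventually.of_forall fun T ↦ ?_)
  simp only [Pi.inv_apply, Function.comp_apply, div_eq_mul_inv]

open AH in
/-- **BGSTB 2025, Lemma 6 (v) with the printed error terms, SPLIT (M-uniform) constants** — the
PRIMARY statement of this file. Under RH there are ABSOLUTE constants `K₀, A > 0` such that for every
AH-Pairs level `M > 0` with `AHPairsAt M` and every bin half-width `0 < δ ≤ 1/2` there is a positive
rate `R'(T) → 0` with, for all large `T`, all `0 < λ ≤ 1/4` and all odd `K`,
`|G_λ(K) − 2(P₀ − 1)/λ| ≤ K₀(1 + A/(λ⁵M) + 1/(λ⁵√log T)) + K₀((|K|+1)(M/A)² R'(T) + 1/log T)/λ`: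
the level `M` enters the `T`-persistent part only through the printed `1/(λ⁵M)` (the `1/(λ²𝓜)` of
`E_G(λ², K)/λ` at `λ²`), with an absolute constant; the level-dependent data multiply `T`-vanishing
terms only. Inputs: `bgstb2025_lemma5_rh_holds`, the row-U uniform input `AH.exists_uniform_input`,
the RH window bound `exists_integral_formFactor_window_le`, and the cores (§2 here, §§2–3 of
`AlternativeHypothesisLemma6PrintedRateProofs`) fed with `C₂ = 1` at level `M/A`. OURS (the
M-uniform reading of the printed (v); cell conventions of rows U).
[cite: BaluyotGoldstonSuriajayaTurnageButterbaugh2025, Lemma 6 (v)] -/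
theorem bgstb2025_lemma6_v_printed_usplit (hRH : RiemannHypothesis) :
    ∃ K₀ A : ℝ, 0 < K₀ ∧ 0 < A ∧ ∀ M : ℝ, 0 < M → AHPairsAt M → ∀ δ : ℝ, 0 < δ → δ ≤ 1 / 2 →
      ∃ R' : ℝ → ℝ, (∀ T, 0 < R' T) ∧ Tendsto R' atTop (𝓝 0) ∧ ∀ᶠ T : ℝ in atTop,
        ∀ lam : ℝ, 0 < lam → lam ≤ 1 / 4 → ∀ K : ℤ, Odd K →
          |AH.heathBrownG lam K T - 2 * (AH.binDensity 0 T M δ - 1) / lam| ≤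
            K₀ * (1 + A / (lam ^ 5 * M) + 1 / (lam ^ 5 * Real.sqrt (Real.log T))) +
              K₀ * ((|(K : ℝ)| + 1) * (M / A) ^ 2 * R' T + 1 / Real.log T) / lam := by
  obtain ⟨C₁, h₁⟩ := (bgstb2025_lemma5_rh_holds hRH).2
  obtain ⟨A, hA, hU⟩ := AH.exists_uniform_input hRH
  obtain ⟨CF, hF⟩ := exists_integral_formFactor_window_le hRH
  obtain ⟨K₀, hK₀⟩ : ∃ K₀ : ℝ,
      K₀ = 3 * abs (18 * abs (1 : ℝ) + 12 * abs C₁ + 8) + 2 * abs (8 * abs (1 : ℝ)) +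
        2 * abs CF := ⟨_, rfl⟩
  refine ⟨K₀, A, by rw [hK₀]; positivity, hA, ?_⟩
  intro M hM hAHM δ hδ hδ2
  obtain ⟨R', hR0, hRlim, h₂⟩ := hU M hM hAHM δ hδ hδ2
  refine ⟨R', hR0, hRlim, ?_⟩
  have hM' : 0 < M / A := by positivity
  have hW := corollary5_window_core (C₂ := 1) (Mb := M) hM' hR0 (by linarith) h₁ h₂
  have hTr := heathBrownG_window_transport_core (C₂ := 1) hM' hR0
    (h₂.mono fun T hT lam hlam hlam2 α L ↦ (hT lam hlam hlam2 α).2 L)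
  have hcore := lemma6_v_printed_core hM' hR0 hW hTr hF
  filter_upwards [hcore] with T hT lam hlam hlam4 K hK
  have h := hT lam hlam hlam4 K hK
  rw [AH.errG_level_div hA.ne' hM.ne' (by positivity : lam ^ 2 ≠ 0)] at h
  rw [show (lam ^ 2) ^ 2 * M = lam ^ 4 * M by ring] at h
  refine h.trans (le_of_eq ?_)
  rw [hK₀]
  have hl : lam ≠ 0 := hlam.ne'
  field_simp
  ring

open AH in
/-- **The printed `O(1)` of (v), M-free form.** Assume RH and AH-Pairs. There is an ABSOLUTE
`K₀ > 0` such that for every bin half-width `0 < δ ≤ 1/2`, every bin parameter `M_b ≥ δ/2` (the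
diagonal bin does not depend on it), every odd `K`, every `0 < λ ≤ 1/4` and every `ε > 0`, for all
large `T`: `|λ G_λ(K, T) − 2(P₀(T) − 1)| ≤ K₀ λ + ε` — i.e. "`λ G_λ(K) = 2(P_0 − 1) + O(λ) + o(1)`
(`T → ∞`)" with an absolute `O`-constant, the level `M` of AH-Pairs having been sent to infinity
inside the proof (`M ≥ 3K₀A/(λ⁴ε)`). OURS (the reading of the printed (v) in the sense of §7 of the
source, TeX l. 1057: "we are taking `T → ∞` and then making `M` large and `λ` appropriately small");
compare `AH.window_odd_printedRate` (the same for the flat window, from (iii)).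
[cite: BaluyotGoldstonSuriajayaTurnageButterbaugh2025, Lemma 6 (v)] -/
theorem AH.heathBrownG_odd_printedRate (hRH : RiemannHypothesis) (hAH : AHPairs) :
    ∃ K₀ : ℝ, 0 < K₀ ∧ ∀ δ : ℝ, 0 < δ → δ ≤ 1 / 2 → ∀ Mb : ℝ, δ / 2 ≤ Mb → ∀ K : ℤ, Odd K →
      ∀ lam : ℝ, 0 < lam → lam ≤ 1 / 4 → ∀ ε : ℝ, 0 < ε → ∀ᶠ T : ℝ in atTop,
        |lam * AH.heathBrownG lam K T - 2 * (AH.binDensity 0 T Mb δ - 1)| ≤ K₀ * lam + ε := by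
  obtain ⟨K₀, A, hK₀, hA, h⟩ := bgstb2025_lemma6_v_printed_usplit hRH
  refine ⟨K₀, hK₀, ?_⟩
  intro δ hδ hδ2 Mb hMb K hK lam hlam hlam4 ε hε
  -- the AH level: large enough to see the bin and to make `K₀ A/(λ⁴ M) ≤ ε/3`
  obtain ⟨M, hM⟩ : ∃ M : ℝ, M = Mb + 1 + 3 * K₀ * A / (lam ^ 4 * ε) := ⟨_, rfl⟩
  have hM0 : 0 < M := by
    rw [hM]
    have : 0 ≤ 3 * K₀ * A / (lam ^ 4 * ε) := by positivity
    linarith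
  have hMMb : Mb ≤ M := by
    rw [hM]
    have : 0 ≤ 3 * K₀ * A / (lam ^ 4 * ε) := by positivity
    linarith
  have hMA : K₀ * (A / (lam ^ 4 * M)) ≤ ε / 3 := by
    have hMge : 3 * K₀ * A / (lam ^ 4 * ε) ≤ M := by rw [hM]; linarith
    rw [div_le_iff₀ (by positivity)] at hMge
    rw [mul_div_assoc', div_le_iff₀ (by positivity)]
    nlinarith
  obtain ⟨R', hR0, hRlim, hT⟩ := h M hM0 (hAH M hM0) δ hδ hδ2
  -- bin independence
  have hbin : ∀ T, AH.binDensity 0 T M δ = AH.binDensity 0 T Mb δ := fun T ↦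
    AH.binDensity_eq_binDensity_of_le (k := 0) (by simp; linarith) (by simp; linarith)
  -- the `T`-vanishing part
  have hvan : Tendsto (fun T : ℝ ↦ K₀ * (1 / (lam ^ 4 * Real.sqrt (Real.log T))) +
      K₀ * ((|(K : ℝ)| + 1) * (M / A) ^ 2 * R' T + 1 / Real.log T)) atTop (𝓝 0) := by
    have hs : Tendsto (fun T : ℝ ↦ 1 / (lam ^ 4 * Real.sqrt (Real.log T))) atTop (𝓝 0) := by
      have h := tendsto_const_div_sqrt_log'' (1 / lam ^ 4)
      refine h.congr' (Eventually.of_forall fun T ↦ ?_)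
      rw [div_div]
    have h := (hs.const_mul K₀).add
      (((hRlim.const_mul ((|(K : ℝ)| + 1) * (M / A) ^ 2)).add tendsto_one_div_log'').const_mul K₀)
    simp only [mul_zero, add_zero] at h
    exact h
  filter_upwards [hT, hvan.eventually (gt_mem_nhds (show (0 : ℝ) < ε / 3 by positivity))]
    with T hTT hsmall
  have hb := hTT lam hlam hlam4 K hK
  rw [hbin T] at hb
  have hsmall' : K₀ * (1 / (lam ^ 4 * Real.sqrt (Real.log T))) +
      K₀ * ((|(K : ℝ)| + 1) * (M / A) ^ 2 * R' T + 1 / Real.log T) < ε / 3 := hsmall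
  -- multiply the pointwise bound by `λ`
  have hl : lam ≠ 0 := hlam.ne'
  have e1 : lam * AH.heathBrownG lam K T - 2 * (AH.binDensity 0 T Mb δ - 1) =
      lam * (AH.heathBrownG lam K T - 2 * (AH.binDensity 0 T Mb δ - 1) / lam) := by
    field_simp
  rw [e1, abs_mul, abs_of_pos hlam]
  have hb' := mul_le_mul_of_nonneg_left hb hlam.le
  have e2 : lam * (K₀ * (1 + A / (lam ^ 5 * M) + 1 / (lam ^ 5 * Real.sqrt (Real.log T))) +
      K₀ * ((|(K : ℝ)| + 1) * (M / A) ^ 2 * R' T + 1 / Real.log T) / lam) =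
      K₀ * lam + K₀ * (A / (lam ^ 4 * M)) +
        (K₀ * (1 / (lam ^ 4 * Real.sqrt (Real.log T))) +
          K₀ * ((|(K : ℝ)| + 1) * (M / A) ^ 2 * R' T + 1 / Real.log T)) := by
    field_simp
    ring
  linarith [hb', e2.le, hMA, hsmall'.le]

end Literature.NumberTheory.LFunctions

end
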